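import Summits.Ventures.PercRepro.ProfilePointedCircuitClassesStarSharpPencilF

/-!
# PercRepro — THE PENCIL THROUGH `ℓ ∈ X`, PART G: THE F-CLASS — THE PLANE `P_f`, THE DEFECT SPLIT, THE C-TARGETS
(p5, gen 56; `proofs/P5-GM1.md` §83)

A bad demand without `c1` has its pair inside the plane `P_f = cl{e, f, ℓ}` (`pencilX_F_pair_in_Pf`); at most two
points of `X − ℓ` lie on `P_f` (`pencilX_card_A_le_two`, by `hfc`); such a demand is a B1 or a B2 defect
(`pencilX_F_B1_or_B2`: its swap, when it exists, is ON because the plane `P_f` contains the ON line).  The C-targets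
of the F-class: a bad demand `{ℓ, a} + e + b` makes `ℓ` or `a` a C-point (`pencilX_F_la_cpoint`), a bad demand
`{a, a′} + e + b` makes `a` or `a′` a C-point (`pencilX_F_aa'_cpoint`); two points of `P_f` on the line `ef` carry at
most one bad demand with `ℓ` (`pencilX_F_not_both_la`) and no demand `{a, a′}` (`pencilX_F_not_aa'_of_line_ef`).
-/

open scoped Matroid

namespace PercRepro.Cogirth

open Finset ThmH Skew Shadow Profile

open Classical

variable {α : Type} [DecidableEq α] {N : Matroid α} [N.Finite]

section StarSharpPencilG

variable {b b' : α}

/-- `((W − b) − e) = {x, y}` for `W = {x, y} + e + b`. -/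
theorem erase_erase_insert_b_insert_e {b e x y : α} (hxb : x ≠ b) (hxe : x ≠ e) (hyb : y ≠ b) (hye : y ≠ e)
    (heb : e ≠ b) : ((insert b (insert e ({x, y} : Finset α))).erase b).erase e = {x, y} := by
  rw [erase_insert, erase_insert]
  · simp only [mem_insert, mem_singleton, not_or]; exact ⟨hxe.symm, hye.symm⟩
  · simp only [mem_insert, mem_singleton, not_or]; exact ⟨heb.symm, hxb.symm, hyb.symm⟩

/-- `{e, f, ℓ} + a = {ℓ, a} + e + f`. -/
theorem insert_a_efl_eq (e f l a : α) : insert a ({e, f, l} : Finset α) = insert f (insert e {l, a}) := by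
  ext z; simp only [mem_insert, mem_singleton]; tauto

/-- `{e, f} + x = {e, f, x}`. -/
theorem insert_x_ef_eq (e f x : α) : insert x ({e, f} : Finset α) = {e, f, x} := by
  ext z; simp only [mem_insert, mem_singleton]; tauto

/-- `X − x = (X ∖ {x, y}) + y` for `y ∈ X`, `x ≠ y`. -/
theorem erase_eq_insert_sdiff_pair {X : Finset α} {x y : α} (hy : y ∈ X) (hxy : x ≠ y) :
    X.erase x = insert y (X \ {x, y}) := by
  ext z
  simp only [mem_erase, mem_insert, mem_sdiff, mem_singleton, not_or]
  constructor
  · rintro ⟨hzx, hz⟩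
    by_cases hzy : z = y
    · exact Or.inl hzy
    · exact Or.inr ⟨hz, hzx, hzy⟩
  · rintro (rfl | ⟨hz, hzx, hzy⟩)
    · exact ⟨hxy.symm, hy⟩
    · exact ⟨hzx, hz⟩

/-- `(E₇ − f) − x = (X − x) + e` for `x ∈ X`. -/
theorem E7_erase_f_erase_eq_insert_e {e f x : α} (he : e ∈ gr N) (hef : e ≠ f) (heb : e ≠ b) (heb' : e ≠ b')
    (hx : x ∈ ((((gr N).erase b).erase b').erase f).erase e) :
    ((((gr N).erase b).erase b').erase f).erase x = insert e ((((((gr N).erase b).erase b').erase f).erase e).erase x) := by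
  have hxe : x ≠ e := (mem_erase.1 hx).1
  ext z
  simp only [mem_erase, mem_insert]
  constructor
  · rintro ⟨hzx, hzf, hzb', hzb, hzg⟩
    by_cases hze : z = e
    · exact Or.inl hze
    · exact Or.inr ⟨hzx, hze, hzf, hzb', hzb, hzg⟩
  · rintro (rfl | ⟨hzx, hze, hzf, hzb', hzb, hzg⟩)
    · exact ⟨hxe.symm, hef, heb', heb, he⟩
    · exact ⟨hzx, hzf, hzb', hzb, hzg⟩

/-- `{ℓ, a₁, a₂, a₃} + e ⊆ {e, f, ℓ} ∪ {a₁, a₂, a₃}`. -/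
theorem insert_e_quad_subset_union (e f l a₁ a₂ a₃ : α) :
    insert e ({l, a₁, a₂, a₃} : Finset α) ⊆ {e, f, l} ∪ {a₁, a₂, a₃} := by
  intro z hz; simp only [mem_insert, mem_singleton, mem_union] at hz ⊢; tauto

/-- `{x, y} + f ⊆ {e, f, ℓ} ∪ {x, y}`. -/
theorem insert_f_pair_subset_union_efl (e f l x y : α) :
    insert f ({x, y} : Finset α) ⊆ {e, f, l} ∪ {x, y} := by
  intro z hz; simp only [mem_insert, mem_singleton, mem_union] at hz ⊢; tauto

/-- `({x, y} + f) ∪ {e, ℓ} ⊆ {x, y} + f + e + ℓ`. -/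
theorem insert_f_pair_union_el_subset (e f l x y : α) :
    insert f ({x, y} : Finset α) ∪ {e, l} ⊆ insert l (insert e (insert f {x, y})) := by
  intro z hz; simp only [mem_union, mem_insert, mem_singleton] at hz ⊢; tauto

/-- The data of an explicit demand `{x, y} + e + b ∈ d0DON`. -/
theorem d0DON_pair_data (hn : (gr N).card = 9) (h : SeriesPair N b b') {e f : α} (he : e ∈ gr N) (hf : f ∈ gr N)
    (hef : e ≠ f) (heb : e ≠ b) (heb' : e ≠ b') (hfb : f ≠ b) (hfb' : f ≠ b')
    {x y : α} (hx : x ∈ ((((gr N).erase b).erase b').erase f).erase e)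
    (hy : y ∈ ((((gr N).erase b).erase b').erase f).erase e)
    (hW : insert b (insert e {x, y}) ∈ d0DON N b' e f) :
    rk N (insert e {x, y}) = 3 ∧ rk N (insert f (((((gr N).erase b).erase b').erase f).erase e \ {x, y})) = 4 ∧
      rk N (((((gr N).erase b).erase b').erase f).erase e \ {x, y}) = 3 ∧
      rk N (insert b (insert b' (insert e {x, y}))) = 4 := by
  have hxb : x ≠ b := (mem_erase.1 ((erase_subset _ _) ((erase_subset _ _) ((erase_subset _ _) hx)))).1
  have hxe : x ≠ e := (mem_erase.1 hx).1
  have hyb : y ≠ b := (mem_erase.1 ((erase_subset _ _) ((erase_subset _ _) ((erase_subset _ _) hy)))).1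
  have hye : y ≠ e := (mem_erase.1 hy).1
  have hWd := hW
  simp only [d0DON, mem_filter] at hWd
  obtain ⟨-, hπX, hπ2, -, -, hπe, hYf, hon⟩ :=
    d0_demand_data h hn hf hef heb hfb hfb' (e := e) _ hWd.1 hWd.2.1 hWd.2.2
  rw [erase_erase_insert_b_insert_e hxb hxe hyb hye heb] at hπX hπ2 hπe hYf hon
  exact ⟨hπe, hYf, d0_S3 h hn he hf hef heb heb' hfb hfb' _ hπX hπ2 hYf, hon⟩

/-- **THE PAIR OF A BAD DEMAND WITHOUT `c1` LIES ON `P_f`**: `ρ{e, f, ℓ, x} ≤ 3` for `x ∈ π`. -/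
theorem pencilX_F_pair_in_Pf (hn : (gr N).card = 9) (h : SeriesPair N b b') {e f : α} (he : e ∈ gr N)
    (hf : f ∈ gr N) (hef : e ≠ f) (heb : e ≠ b) (heb' : e ≠ b') (hfb : f ≠ b) (hfb' : f ≠ b')
    (he1 : ∀ y ∈ ((((gr N).erase b).erase b').erase f).erase e, rk N {e, y} = 2) (heb3 : rk N {e, b, b'} = 3)
    {l : α} (hlX : l ∈ ((((gr N).erase b).erase b').erase f).erase e) (hlon : rk N (insert b (insert b' {e, l})) = 3)
    {W : Finset α} (hW : W ∈ d0DON N b' e f) (hc1 : ¬ d0c1 N b e f W) :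
    ∀ x ∈ (W.erase b).erase e, rk N (insert f (insert e {l, x})) ≤ 3 := by
  have hXE : ((((gr N).erase b).erase b').erase f).erase e ⊆ ((gr N).erase b).erase b' :=
    (erase_subset _ _).trans (erase_subset _ _)
  have heE : e ∈ ((gr N).erase b).erase b' := mem_erase.2 ⟨heb', mem_erase.2 ⟨heb, he⟩⟩
  have hWd := hW
  simp only [d0DON, mem_filter] at hWd
  obtain ⟨-, hπX, hπ2, -, -, hπe, -, hon⟩ :=
    d0_demand_data h hn hf hef heb hfb hfb' (e := e) W hWd.1 hWd.2.1 hWd.2.2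
  intro x hx
  unfold d0c1 at hc1
  have h1 := rk_le_card' (M := N) (insert f (insert e ((W.erase b).erase e)))
  have h2 := card_insert_le f (insert e ((W.erase b).erase e))
  have h3 := card_insert_le e ((W.erase b).erase e)
  have hc1' : rk N (insert f (insert e ((W.erase b).erase e))) ≤ 3 := by omega
  have hlcl : rk N (insert l (insert e ((W.erase b).erase e))) = rk N (insert e ((W.erase b).erase e)) :=
    (on_iff_of_line_el h he he1 heb3 hlX hlon (insert_subset heE (hπX.trans hXE)) (mem_insert_self _ _)).1
      (by rw [hπe]; exact hon)
  have h4 := rk_insert_eq_of_rk_insert_eq_subset' (N := N) (S := insert e ((W.erase b).erase e))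
    (S' := insert f (insert e ((W.erase b).erase e))) (subset_insert _ _) hlcl
  have h5 : rk N (insert f (insert e {l, x})) ≤ rk N (insert l (insert f (insert e ((W.erase b).erase e)))) := by
    apply rk_mono'
    intro z hz
    simp only [mem_insert, mem_singleton] at hz
    rcases hz with rfl | rfl | rfl | rfl
    · exact mem_insert_of_mem (mem_insert_self _ _)
    · exact mem_insert_of_mem (mem_insert_of_mem (mem_insert_self _ _))
    · exact mem_insert_self _ _
    · exact mem_insert_of_mem (mem_insert_of_mem (mem_insert_of_mem hx))
  rw [h4] at h5
  omega

/-- **AT MOST TWO POINTS OF `X − ℓ` LIE ON `P_f`** (three would put `(X + e) − d` on the plane, against `hfc`). -/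
theorem pencilX_card_A_le_two (hn : (gr N).card = 9) (h : SeriesPair N b b') {e f : α} (he : e ∈ gr N)
    (hf : f ∈ gr N) (hef : e ≠ f) (heb : e ≠ b) (heb' : e ≠ b') (hfb : f ≠ b) (hfb' : f ≠ b')
    (hfc : ∀ y ∈ ((((gr N).erase b).erase b').erase f).erase e, rk N (((((gr N).erase b).erase b').erase f).erase y) = 4)
    {l : α} (hlX : l ∈ ((((gr N).erase b).erase b').erase f).erase e) (hefl : rk N {e, f, l} = 3) :
    ((((((gr N).erase b).erase b').erase f).erase e).filter
      (fun x => x ≠ l ∧ rk N (insert f (insert e {l, x})) ≤ 3)).card ≤ 2 := by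
  set X := ((((gr N).erase b).erase b').erase f).erase e with hXdef
  set A := X.filter (fun x => x ≠ l ∧ rk N (insert f (insert e {l, x})) ≤ 3) with hAdef
  by_contra hlt
  push Not at hlt
  obtain ⟨a₁, h₁, a₂, h₂, a₃, h₃, h₁₂, h₁₃, h₂₃⟩ := two_lt_card.1 hlt
  have hmem : ∀ a ∈ A, a ∈ X ∧ a ≠ l ∧ rk N (insert a {e, f, l}) = 3 := by
    intro a ha
    rw [hAdef, mem_filter] at ha
    refine ⟨ha.1, ha.2.1, ?_⟩
    have h1 : rk N {e, f, l} ≤ rk N (insert f (insert e {l, a})) := by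
      rw [← insert_a_efl_eq]; exact rk_mono' (subset_insert _ _)
    rw [insert_a_efl_eq]
    rw [hefl] at h1
    have := ha.2.2
    omega
  obtain ⟨ha₁X, ha₁l, ha₁⟩ := hmem a₁ h₁
  obtain ⟨ha₂X, ha₂l, ha₂⟩ := hmem a₂ h₂
  obtain ⟨ha₃X, ha₃l, ha₃⟩ := hmem a₃ h₃
  -- the fifth point `d` of `X`
  have hsub : ({l, a₁, a₂, a₃} : Finset α) ⊆ X := by
    intro z hz
    simp only [mem_insert, mem_singleton] at hz
    rcases hz with rfl | rfl | rfl | rfl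
    · exact hlX
    · exact ha₁X
    · exact ha₂X
    · exact ha₃X
  have hcard4 : ({l, a₁, a₂, a₃} : Finset α).card = 4 := by
    rw [card_insert_of_notMem, card_insert_of_notMem, card_pair h₂₃]
    · simp only [mem_insert, mem_singleton, not_or]; exact ⟨h₁₂, h₁₃⟩
    · simp only [mem_insert, mem_singleton, not_or]; exact ⟨ha₁l.symm, ha₂l.symm, ha₃l.symm⟩
  have hX5 : X.card = 5 := card_X_eq_five hn h he hf hef heb heb' hfb hfb'
  obtain ⟨d, hdX, hd⟩ := exists_mem_notMem_of_card_lt_card (by rw [hcard4, hX5]; exact Nat.lt_succ_self 4 : ({l, a₁, a₂, a₃} : Finset α).card < X.card)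
  simp only [mem_insert, mem_singleton, not_or] at hd
  obtain ⟨hdl, hd₁, hd₂, hd₃⟩ := hd
  -- `X − d = {ℓ, a₁, a₂, a₃}`
  have hXd : X.erase d = {l, a₁, a₂, a₃} := by
    symm
    apply eq_of_subset_of_card_le
    · intro z hz
      simp only [mem_insert, mem_singleton] at hz
      rcases hz with rfl | rfl | rfl | rfl
      · exact mem_erase.2 ⟨fun h' => hdl h'.symm, hlX⟩
      · exact mem_erase.2 ⟨fun h' => hd₁ h'.symm, ha₁X⟩
      · exact mem_erase.2 ⟨fun h' => hd₂ h'.symm, ha₂X⟩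
      · exact mem_erase.2 ⟨fun h' => hd₃ h'.symm, ha₃X⟩
    · rw [card_erase_of_mem hdX, hX5, hcard4]
  -- the plane `cl{e, f, ℓ}` contains `a₁, a₂, a₃`
  have hall : ∀ z ∈ ({a₁, a₂, a₃} : Finset α), rk N (insert z {e, f, l}) = rk N {e, f, l} := by
    intro z hz
    simp only [mem_insert, mem_singleton] at hz
    rcases hz with rfl | rfl | rfl
    · rw [ha₁, hefl]
    · rw [ha₂, hefl]
    · rw [ha₃, hefl]
  have h5 := rk_union_eq_of_forall_insert_eq (N := N) (Y := {e, f, l}) {a₁, a₂, a₃} hall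
  have h6 : rk N (((((gr N).erase b).erase b').erase f).erase d) ≤ rk N ({e, f, l} ∪ {a₁, a₂, a₃}) := by
    apply rk_mono'
    rw [E7_erase_f_erase_eq_insert_e he hef heb heb' hdX, hXd]
    exact insert_e_quad_subset_union e f l a₁ a₂ a₃
  rw [hfc d hdX, h5, hefl] at h6
  omega

/-- **A BAD DEMAND WITHOUT `c1` IS A B1 OR A B2 DEFECT**: for `{x, y} + e + b ∈ d0DON` with `x, y ∈ P_f` and `¬c0`,
either `ρ(π + f) = 2` or `e ∈ cl(X ∖ π)` (a swap of rank 3 would be ON, since `cl(π + f) = P_f ⊇ {e, ℓ}`). -/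
theorem pencilX_F_B1_or_B2 (hn : (gr N).card = 9) (h : SeriesPair N b b') {e f : α} (he : e ∈ gr N)
    (hf : f ∈ gr N) (hef : e ≠ f) (heb : e ≠ b) (heb' : e ≠ b') (hfb : f ≠ b) (hfb' : f ≠ b')
    (he1 : ∀ y ∈ ((((gr N).erase b).erase b').erase f).erase e, rk N {e, y} = 2)
    {l : α} (hlX : l ∈ ((((gr N).erase b).erase b').erase f).erase e) (hlon : rk N (insert b (insert b' {e, l})) = 3)
    (hefl : rk N {e, f, l} = 3)
    {x y : α} (hx : x ∈ ((((gr N).erase b).erase b').erase f).erase e)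
    (hy : y ∈ ((((gr N).erase b).erase b').erase f).erase e) (hxy : x ≠ y)
    (hxP : rk N (insert x {e, f, l}) = 3) (hyP : rk N (insert y {e, f, l}) = 3)
    (hW : insert b (insert e {x, y}) ∈ d0DON N b' e f) (hc0 : ¬ d0c0 N b b' e f (insert b (insert e {x, y}))) :
    rk N (insert f {x, y}) = 2 ∨ rk N (insert e (((((gr N).erase b).erase b').erase f).erase e \ {x, y})) = 3 := by
  have hXE : ((((gr N).erase b).erase b').erase f).erase e ⊆ ((gr N).erase b).erase b' :=
    (erase_subset _ _).trans (erase_subset _ _)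
  have hXg : ((((gr N).erase b).erase b').erase f).erase e ⊆ gr N :=
    hXE.trans ((erase_subset _ _).trans (erase_subset _ _))
  have hfE : f ∈ ((gr N).erase b).erase b' := mem_erase.2 ⟨hfb', mem_erase.2 ⟨hfb, hf⟩⟩
  have hxb : x ≠ b := (mem_erase.1 ((erase_subset _ _) ((erase_subset _ _) ((erase_subset _ _) hx)))).1
  have hxe : x ≠ e := (mem_erase.1 hx).1
  have hyb : y ≠ b := (mem_erase.1 ((erase_subset _ _) ((erase_subset _ _) ((erase_subset _ _) hy)))).1
  have hye : y ≠ e := (mem_erase.1 hy).1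
  obtain ⟨hπe, hYf, hτ3, -⟩ := d0DON_pair_data hn h he hf hef heb heb' hfb hfb' hx hy hW
  unfold d0c0 at hc0
  rw [erase_erase_insert_b_insert_e hxb hxe hyb hye heb] at hc0
  by_contra hno
  push Not at hno
  -- bounds: `ρ(π + f) ∈ {2, 3}`, `ρ((X ∖ π) + e) ∈ {3, 4}`
  have h1 := rk_le_card' (M := N) (insert f ({x, y} : Finset α))
  have h2 := card_insert_le f ({x, y} : Finset α)
  have h3 := card_le_two (a := x) (b := y)
  have h4 : rk N (insert f {x, y}) ≥ 2 := by
    have h5 := rk_insert_le_add_one (N := N) he (X := ({x, y} : Finset α))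
      (insert_subset (hXg hx) (singleton_subset_iff.2 (hXg hy)))
    have h6 : rk N {x, y} ≤ rk N (insert f {x, y}) := rk_mono' (subset_insert _ _)
    omega
  have hπf : rk N (insert f {x, y}) = 3 := by omega
  have h7 := rk_insert_le_add_one (N := N) he (X := ((((gr N).erase b).erase b').erase f).erase e \ {x, y})
    (sdiff_subset.trans hXg)
  have h8 : rk N (((((gr N).erase b).erase b').erase f).erase e \ {x, y}) ≤
      rk N (insert e (((((gr N).erase b).erase b').erase f).erase e \ {x, y})) := rk_mono' (subset_insert _ _)
  have hτe : rk N (insert e (((((gr N).erase b).erase b').erase f).erase e \ {x, y})) = 4 := by omega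
  -- the swap `{x, y} + f` spans `P_f`, hence is ON
  have hall : ∀ z ∈ ({x, y} : Finset α), rk N (insert z {e, f, l}) = rk N {e, f, l} := by
    intro z hz
    simp only [mem_insert, mem_singleton] at hz
    rcases hz with rfl | rfl
    · rw [hxP, hefl]
    · rw [hyP, hefl]
  have hU := rk_union_eq_of_forall_insert_eq (N := N) (Y := {e, f, l}) {x, y} hall
  have hsub : insert f ({x, y} : Finset α) ⊆ {e, f, l} ∪ {x, y} := insert_f_pair_subset_union_efl e f l x y
  have hecl : rk N (insert e (insert f {x, y})) = rk N (insert f {x, y}) :=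
    rk_insert_eq_of_subset_rk_eq hsub (by rw [hU, hefl, hπf])
      (by rw [insert_eq_of_mem (mem_union_left _ (mem_insert_self _ _))])
  have hlcl : rk N (insert l (insert f {x, y})) = rk N (insert f {x, y}) :=
    rk_insert_eq_of_subset_rk_eq hsub (by rw [hU, hefl, hπf])
      (by rw [insert_eq_of_mem (mem_union_left _ (mem_insert_of_mem (mem_insert_of_mem (mem_singleton_self _))))])
  have hS : insert f ({x, y} : Finset α) ⊆ ((gr N).erase b).erase b' :=
    insert_subset hfE (insert_subset (hXE hx) (singleton_subset_iff.2 (hXE hy)))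
  have hon := on_of_on_subset_cl h hS (S₀ := {e, l}) (by rw [hlon, he1 l hlX]) (by
    have h9 : rk N (insert f {x, y} ∪ {e, l}) ≤ rk N (insert l (insert e (insert f {x, y}))) :=
      rk_mono' (insert_f_pair_union_el_subset e f l x y)
    have h10 := rk_insert_eq_of_rk_insert_eq_subset' (N := N) (S := insert f {x, y})
      (S' := insert e (insert f {x, y})) (subset_insert _ _) hlcl
    rw [h10, hecl] at h9
    have h11 : rk N (insert f {x, y}) ≤ rk N (insert f {x, y} ∪ {e, l}) := rk_mono' subset_union_left
    omega)
  rw [hπf] at hon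
  exact hc0 ⟨hπf, hτe, hon⟩

end StarSharpPencilG

end PercRepro.Cogirth
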